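import Literature.MathematicalPhysics.QuantumManyBody.FoldyIntegral
import Mathlib.MeasureTheory.Constructions.HaarToSphere
import Mathlib.MeasureTheory.Measure.Lebesgue.VolumeOfBalls
import HarnessLib

/-!
# The Bogoliubov–Foldy momentum integral

Topic `Literature/MathematicalPhysics/QuantumManyBody` (groundwork for `JelliumBoseGas.foldyLaw`,
[LSSY2005, Thm. 10.1]; continuation of `FoldyIntegral.lean`). In Bogoliubov's approximation for
jellium each pair of momenta `±k` contributes `-½ (A_k + B_k - √((A_k + B_k)² - B_k²))` to the
ground-state energy, `A_k = |k|²` the kinetic energy (units `ħ = 2m = 1`) and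
`B_k = ρ v̂(k) = 4πqρ/|k|²` the background density times the Fourier transform of the Coulomb
potential of coupling `q` [LSSY2005, Thm. 10.3 and §10.3; LiebSolovej2001, (1.4) and Thm. 6.3
(= `Bogoliubov.LiebSolovej2001_simple_bogoliubov` of `BogoliubovSimpleMethod.lean`)]. In the
thermodynamic limit the sum over `k ∈ (2π/L)ℤ³` becomes `L³ (2π)⁻³ ∫ d³k`, and the resulting
energy per volume is Foldy's `-foldyConstant · q^{5/4} ρ^{5/4}` [Foldy1961; LSSY2005, (10.2)]:

**`½ (2π)⁻³ ∫_{ℝ³} (|k|² + 4πqρ |k|⁻² - √(|k|⁴ + 8πqρ)) d³k = foldyConstant · q^{5/4} ρ^{5/4}`.**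

This is where the constant of Foldy's law comes from in BOTH halves of the printed proof (the
lower bound [LiebSolovej2001, §6 and (1.4)–(1.5)] and the upper bound [Solovej2006, (2)]). Proof:
polar coordinates (`integral_fun_norm_addHaar`, `|B(0,1)| = 4π/3`), the scaling `|k| = (4πqρ)^{1/4} x`,
and the one-dimensional Foldy integral `J = ∫₀^∞ (1 + x⁴ - x²√(x⁴ + 2)) dx` in closed form
(`integral_foldyIntegrand`, `foldyConstant_eq_integral`: `foldyConstant = √2 π^{-3/4} J`).

* `JelliumBoseGas.bogoliubovMode_nonneg`, `bogoliubovMode_eq` — per mode,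
  `0 ≤ A + B - √(A² + 2AB)` and `-(A + B) + √((A + B)² - B²) = -(A + B - √(A² + 2AB))`
  (the form of `LiebSolovej2001_simple_bogoliubov`).
* `JelliumBoseGas.bogoliubovRadial_eq_scaled` — `r⁴ + a - r²√(r⁴ + 2a) = a F(a^{-1/4} r)`,
  `F(x) = 1 + x⁴ - x²√(x⁴ + 2)`.
* `JelliumBoseGas.integral_bogoliubovRadial` — **`∫₀^∞ (r⁴ + a - r²√(r⁴ + 2a)) dr = a^{5/4} J`**
  with integrability (`a > 0`).
* `JelliumBoseGas.integral_bogoliubov_norm` — polar coordinates: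
  `∫_{ℝ³} (|k|² + a|k|⁻² - √(|k|⁴ + 2a)) dk = 4π ∫₀^∞ (r⁴ + a - r²√(r⁴ + 2a)) dr`.
* `JelliumBoseGas.bogoliubov_momentum_integral` — **the displayed identity**.

## References

* [LSSY2005] E. H. Lieb, R. Seiringer, J. P. Solovej, J. Yngvason, *The Mathematics of the Bose
  Gas and its Condensation* (2005), Thm. 10.1 (10.2), Thm. 10.3, §10.3 (arXiv Ch. 12, pp. 74–78).
* [LiebSolovej2001] E. H. Lieb, J. P. Solovej, Commun. Math. Phys. 217 (2001) 127–163, (1.4)–(1.5),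
  Thm. 6.3.
* [Solovej2006] J. P. Solovej, Commun. Math. Phys. 266 (2006) 797–818, (2).
* [Foldy1961] L. L. Foldy, Phys. Rev. 124 (1961) 649–651.
-/

noncomputable section

open MeasureTheory Set Real Metric
open scoped ENNReal

namespace Literature.MathematicalPhysics.QuantumManyBody.JelliumBoseGas

open BoseGas

/-! ### The Bogoliubov energy of one mode -/

/-- Per mode the Bogoliubov correction is nonpositive: `0 ≤ A + B - √(A² + 2AB)` for `A, B ≥ 0`
(`(A + B)² = A² + 2AB + B² ≥ A² + 2AB`). [cite: LSSY2005, Thm. 10.3] -/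
theorem bogoliubovMode_nonneg {A B : ℝ} (hA : 0 ≤ A) (hB : 0 ≤ B) :
    0 ≤ A + B - Real.sqrt (A ^ 2 + 2 * A * B) := by
  have h : Real.sqrt (A ^ 2 + 2 * A * B) ≤ A + B := by
    rw [Real.sqrt_le_left (by positivity)]
    nlinarith [sq_nonneg B]
  linarith

/-- The lower bound of the simple Bogoliubov method in the form used for jellium:
`-(A + B) + √((A + B)² - B²) = -(A + B - √(A² + 2AB))`. [cite: LSSY2005, Thm. 10.3] -/
theorem bogoliubovMode_eq (A B : ℝ) :
    -(A + B) + Real.sqrt ((A + B) ^ 2 - B ^ 2) = -(A + B - Real.sqrt (A ^ 2 + 2 * A * B)) := by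
  rw [show (A + B) ^ 2 - B ^ 2 = A ^ 2 + 2 * A * B by ring]
  ring

/-! ### The radial integral by scaling -/

/-- **Scaling of the radial Bogoliubov integrand**: for `a > 0` and every real `r`,
`r⁴ + a - r²√(r⁴ + 2a) = a · F(a^{-1/4} r)` with `F(x) = 1 + x⁴ - x²√(x⁴ + 2)` the Foldy
integrand of `FoldyIntegral.lean`. [cite: LSSY2005, Thm. 10.1 (10.2)] -/
theorem bogoliubovRadial_eq_scaled {a : ℝ} (ha : 0 < a) (r : ℝ) :
    r ^ 4 + a - r ^ 2 * Real.sqrt (r ^ 4 + 2 * a) =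
      a * (1 + (a ^ (-(1 / 4 : ℝ)) * r) ^ 4 -
        (a ^ (-(1 / 4 : ℝ)) * r) ^ 2 * Real.sqrt ((a ^ (-(1 / 4 : ℝ)) * r) ^ 4 + 2)) := by
  set c : ℝ := a ^ (1 / 4 : ℝ) with hc
  have hc0 : 0 < c := Real.rpow_pos_of_pos ha _
  have hcinv : a ^ (-(1 / 4 : ℝ)) = c⁻¹ := by rw [Real.rpow_neg ha.le, hc]
  have hc4 : c ^ 4 = a := by
    rw [hc, ← Real.rpow_natCast, ← Real.rpow_mul ha.le]
    norm_num
  set s : ℝ := Real.sqrt a with hs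
  have hs0 : 0 < s := Real.sqrt_pos.2 ha
  have hc2 : c ^ 2 = s := by
    rw [hc, hs, ← Real.rpow_natCast, ← Real.rpow_mul ha.le, Real.sqrt_eq_rpow]
    norm_num
  have ha' : a = s ^ 2 := by rw [hs, Real.sq_sqrt ha.le]
  rw [hcinv]
  have hx4 : (c⁻¹ * r) ^ 4 = r ^ 4 / s ^ 2 := by
    rw [mul_pow, inv_pow, hc4, ha']
    ring
  have hx2 : (c⁻¹ * r) ^ 2 = r ^ 2 / s := by
    rw [mul_pow, inv_pow, hc2]
    ring
  have hsq : Real.sqrt (r ^ 4 + 2 * a) = s * Real.sqrt (r ^ 4 / s ^ 2 + 2) := by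
    rw [hs, ← Real.sqrt_mul ha.le, ← hs]
    congr 1
    rw [ha']
    field_simp
  rw [hx4, hx2, hsq, ha']
  field_simp
  ring

/-- **The radial Bogoliubov integral**: for `a > 0`, `r ↦ r⁴ + a - r²√(r⁴ + 2a)` is integrable on
`(0, ∞)` and `∫₀^∞ (r⁴ + a - r²√(r⁴ + 2a)) dr = a^{5/4} J`,
`J = ∫₀^∞ (1 + x⁴ - x²√(x⁴ + 2)) dx` (substitution `r = a^{1/4} x`). [cite: LSSY2005, Thm. 10.1 (10.2)] -/
theorem integral_bogoliubovRadial {a : ℝ} (ha : 0 < a) :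
    IntegrableOn (fun r : ℝ => r ^ 4 + a - r ^ 2 * Real.sqrt (r ^ 4 + 2 * a)) (Ioi 0) ∧
      ∫ r in Ioi (0 : ℝ), (r ^ 4 + a - r ^ 2 * Real.sqrt (r ^ 4 + 2 * a)) =
        a ^ (5 / 4 : ℝ) * ∫ x in Ioi (0 : ℝ), (1 + x ^ 4 - x ^ 2 * Real.sqrt (x ^ 4 + 2)) := by
  set F : ℝ → ℝ := fun x => 1 + x ^ 4 - x ^ 2 * Real.sqrt (x ^ 4 + 2) with hF
  set c : ℝ := a ^ (1 / 4 : ℝ) with hc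
  have hc0 : 0 < c := Real.rpow_pos_of_pos ha _
  have hcinv : a ^ (-(1 / 4 : ℝ)) = c⁻¹ := by rw [Real.rpow_neg ha.le, hc]
  have hfun : (fun r : ℝ => r ^ 4 + a - r ^ 2 * Real.sqrt (r ^ 4 + 2 * a)) =
      fun r => a * F (c⁻¹ * r) := by
    funext r
    rw [bogoliubovRadial_eq_scaled ha r, hcinv]
  have hac : a * c = a ^ (5 / 4 : ℝ) := by
    rw [hc, show (5 / 4 : ℝ) = 1 + 1 / 4 by norm_num, Real.rpow_add ha, Real.rpow_one]
  obtain ⟨hFi, -⟩ := integral_foldyIntegrand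
  -- integrability of the scaled integrand
  have hFci : IntegrableOn (fun r : ℝ => F (c⁻¹ * r)) (Ioi 0) := by
    rw [integrableOn_Ioi_comp_mul_left_iff F 0 (inv_pos.2 hc0), mul_zero]
    exact hFi
  refine ⟨?_, ?_⟩
  · rw [hfun]
    exact hFci.const_mul a
  · rw [hfun, integral_const_mul, integral_comp_mul_left_Ioi F 0 (inv_pos.2 hc0), mul_zero,
      inv_inv, smul_eq_mul, ← mul_assoc, hac]

/-! ### Polar coordinates and the momentum integral -/

/-- **Polar coordinates for the Bogoliubov momentum integrand**: for `a > 0`,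
`∫_{ℝ³} (|k|² + a|k|⁻² - √(|k|⁴ + 2a)) dk = 4π ∫₀^∞ (r⁴ + a - r²√(r⁴ + 2a)) dr`
(`integral_fun_norm_addHaar`, `|B(0,1)| = 4π/3`, `r² · (r² + a r⁻² - √(r⁴ + 2a)) = r⁴ + a - r²√(r⁴ + 2a)`
for `r > 0`). [cite: LSSY2005, Thm. 10.1 (10.2)] -/
theorem integral_bogoliubov_norm (a : ℝ) :
    ∫ k : Space, (‖k‖ ^ 2 + a * (‖k‖ ^ 2)⁻¹ - Real.sqrt (‖k‖ ^ 4 + 2 * a)) =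
      4 * π * ∫ r in Ioi (0 : ℝ), (r ^ 4 + a - r ^ 2 * Real.sqrt (r ^ 4 + 2 * a)) := by
  have hpolar := integral_fun_norm_addHaar (volume : Measure Space)
    (fun y : ℝ => y ^ 2 + a * (y ^ 2)⁻¹ - Real.sqrt (y ^ 4 + 2 * a))
  rw [hpolar, finrank_euclideanSpace_fin]
  have hball : (volume : Measure Space).real (ball 0 1) = Real.pi * 4 / 3 := by
    rw [measureReal_def, EuclideanSpace.volume_ball_fin_three]
    simp [ENNReal.toReal_ofReal (by positivity : (0 : ℝ) ≤ Real.pi * 4 / 3)]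
  rw [hball]
  have hrad : ∫ y in Ioi (0 : ℝ), y ^ (3 - 1) • (y ^ 2 + a * (y ^ 2)⁻¹ - Real.sqrt (y ^ 4 + 2 * a)) =
      ∫ r in Ioi (0 : ℝ), (r ^ 4 + a - r ^ 2 * Real.sqrt (r ^ 4 + 2 * a)) := by
    refine setIntegral_congr_fun measurableSet_Ioi fun y hy => ?_
    have hy0 : (y : ℝ) ≠ 0 := ne_of_gt hy
    simp only [smul_eq_mul]
    field_simp
  rw [hrad]
  simp only [nsmul_eq_mul, smul_eq_mul]
  push_cast
  ring

/-- `(4π)^{5/4} = 4π · √2 · π^{1/4}` and the bookkeeping of the prefactor: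
`½ (2π)⁻³ · 4π · (4π)^{5/4} = √2 π^{-3/4}`. [folklore] -/
theorem foldy_prefactor :
    1 / 2 * ((2 * π) ^ 3)⁻¹ * (4 * π) * (4 * π) ^ (5 / 4 : ℝ) = Real.sqrt 2 * π ^ (-(3 / 4 : ℝ)) := by
  have hπ : 0 < π := Real.pi_pos
  have h4 : (4 : ℝ) ^ (1 / 4 : ℝ) = Real.sqrt 2 := by
    rw [show (4 : ℝ) = 2 ^ (2 : ℝ) by norm_num, ← Real.rpow_mul (by norm_num), Real.sqrt_eq_rpow]
    norm_num
  have h1 : (4 * π) ^ (5 / 4 : ℝ) = 4 * π * (Real.sqrt 2 * π ^ (1 / 4 : ℝ)) := by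
    rw [show (5 / 4 : ℝ) = 1 + 1 / 4 by norm_num, Real.rpow_add (by positivity), Real.rpow_one,
      Real.mul_rpow (by norm_num) hπ.le, h4]
  have h2 : π ^ (1 / 4 : ℝ) = π * π ^ (-(3 / 4 : ℝ)) := by
    conv_rhs => rw [← Real.rpow_one π, ← Real.rpow_mul hπ.le, ← Real.rpow_add hπ]
    norm_num
  rw [h1, h2]
  field_simp
  ring

/-- **The Bogoliubov–Foldy momentum integral.** For coupling `q > 0` and density `ρ > 0`
(units `ħ = 2m = 1`, Coulomb potential `q|x|⁻¹` with `v̂(k) = 4πq/|k|²`),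
`½ (2π)⁻³ ∫_{ℝ³} (|k|² + 4πqρ|k|⁻² - √(|k|⁴ + 8πqρ)) d³k = foldyConstant · q^{5/4} ρ^{5/4}`:
the Bogoliubov ground-state energy per volume of jellium is `-foldyConstant q^{5/4} ρ^{5/4}`,
i.e. `-foldyConstant q^{5/4} ρ^{1/4}` per particle — the right side of Foldy's law (10.2) in the
tree's units. [cite: LSSY2005, Thm. 10.1 (10.2)] -/
theorem bogoliubov_momentum_integral {q ρ : ℝ} (hq : 0 < q) (hρ : 0 < ρ) :
    1 / 2 * ((2 * π) ^ 3)⁻¹ *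
        ∫ k : Space, (‖k‖ ^ 2 + 4 * π * q * ρ * (‖k‖ ^ 2)⁻¹ - Real.sqrt (‖k‖ ^ 4 + 8 * π * q * ρ)) =
      foldyConstant * q ^ (5 / 4 : ℝ) * ρ ^ (5 / 4 : ℝ) := by
  set a : ℝ := 4 * π * q * ρ with ha
  have ha0 : 0 < a := by positivity
  rw [show 8 * π * q * ρ = 2 * a by rw [ha]; ring, integral_bogoliubov_norm a,
    (integral_bogoliubovRadial ha0).2, foldyConstant_eq_integral]
  set J : ℝ := ∫ x in Ioi (0 : ℝ), (1 + x ^ 4 - x ^ 2 * Real.sqrt (x ^ 4 + 2)) with hJ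
  have hsplit : a ^ (5 / 4 : ℝ) = (4 * π) ^ (5 / 4 : ℝ) * (q ^ (5 / 4 : ℝ) * ρ ^ (5 / 4 : ℝ)) := by
    rw [ha, Real.mul_rpow (by positivity) hρ.le, Real.mul_rpow (by positivity) hq.le, mul_assoc]
  rw [hsplit]
  calc 1 / 2 * ((2 * π) ^ 3)⁻¹ *
        (4 * π * ((4 * π) ^ (5 / 4 : ℝ) * (q ^ (5 / 4 : ℝ) * ρ ^ (5 / 4 : ℝ)) * J))
      = (1 / 2 * ((2 * π) ^ 3)⁻¹ * (4 * π) * (4 * π) ^ (5 / 4 : ℝ)) * J *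
          q ^ (5 / 4 : ℝ) * ρ ^ (5 / 4 : ℝ) := by ring
    _ = Real.sqrt 2 * π ^ (-(3 / 4 : ℝ)) * J * q ^ (5 / 4 : ℝ) * ρ ^ (5 / 4 : ℝ) := by
          rw [foldy_prefactor]

end Literature.MathematicalPhysics.QuantumManyBody.JelliumBoseGas
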